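import Mathlib
import Summits.Ventures.PercRepro2.V2SP

/-! # The one-step relay `Σ` is closed under series AND parallel composition; every series–parallel cube has one
(seat mine-b, cell pub-perc-repro2; MINE-B.md §25.1, §25.5, §28)

A **relay** of a labelled preorder `(X, r, b)` is a map `σ : X → X`, injective on the blue-positive elements
`{b ≥ 1}`, with `σ z ≤ z`, `r (σ z) ≥ 1` and `b z ≤ b (σ z) + 1` for every `z` with `b z ≥ 1` — exactly the
hypothesis `(hσ, hσs)` on the second factor of the series step `universal_ser_of_maps`
(UniversalSeriesStep.lean), and what the chain shift of a bundle provides (`chainShift_relay_spec`,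
BundleRelay.lean).  On a cube with the colour-swap symmetry it is a bijection `{b ≥ 1} → {r ≥ 1}`; its
functional graph is a family of vertex-disjoint strictly decreasing chains from the sources `{r = 0, b ≥ 1}`
onto `{b = 0, r ≥ 1}`, every other blue-positive element fixed.

* `relay_ser` — `(σ x, τ z)` is a relay of the series product (both coordinates red `≥ 1`; the minimum of two
  blue labels that drop by `≤ 1` drops by `≤ 1`).
* `relay_par` — the parallel product.  The naive coordinate rule (`(σ x, z)` if `b x ≥ 1`, else `(x, τ z)`)
  collides at `(o, τ z)` with `b o = 0` (§25.5).  The rule here moves the FIRST coordinate only when it is a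
  non-fixed blue-positive element AND the second coordinate has red label `0`, moves the second coordinate
  only when the first has blue label `0`, and fixes everything else: a moved second coordinate has red label
  `≥ 1`, so the two moved families are separated by the second coordinate's red label, and a fixed element
  has red label `≥ 1` because the blue-positive coordinate that is not moved is either a fixed point of its
  relay (hence a relay image) or sits next to a red-positive coordinate.
* `SP.exists_relay` — every term of the cell's SP grammar has a relay (free edge: `σ true = false`; pinned /
  absent edge: the identity).  So the `σ`-hypothesis of `universal_ser_of_maps` is discharged for EVERY
  second factor `Y` of the cell's grammar (previously: the bundles, by `chainShift_relay_spec`, and a census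
  on the 809 free-edge cubes with ≤ 8 edges, MINE-B.md §25.4).  Remark: (UH*) on `e ∧ Y` — the statement
  that a relay of `Y` is exactly equivalent to (its sources are the `(true, z)` with `b z ≥ 1`, of demand
  `1`, and the targets the `(false, w)` with `r w ≥ 1`) — is already in the tree through
  `SP.universal_of_good` (`e` has flow `1`). -/

namespace Summit.Ventures.PercRepro2.V2Closure

variable {X Y : Type*} [Preorder X] [Preorder Y]

/-- a relay: injective on the blue-positive elements, below, red label `≥ 1`, blue drop `≤ 1` -/
def IsRelay (r b : X → ℕ) (σ : X → X) : Prop :=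
  (∀ z z', 1 ≤ b z → 1 ≤ b z' → σ z = σ z' → z = z') ∧
  (∀ z, 1 ≤ b z → σ z ≤ z ∧ 1 ≤ r (σ z) ∧ b z ≤ b (σ z) + 1)

/-- a fixed point of a relay on a blue-positive element has red label `≥ 1` -/
theorem IsRelay.red_pos_of_fixed {r b : X → ℕ} {σ : X → X} (h : IsRelay r b σ) {z : X} (hz : 1 ≤ b z)
    (hfix : σ z = z) : 1 ≤ r z := by
  have := (h.2 z hz).2.1
  rwa [hfix] at this

/-! ### Series composition -/

/-- **the series product of two relays is a relay**: both coordinates move -/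
theorem relay_ser {r b : X → ℕ} {r' b' : Y → ℕ} {σ : X → X} {τ : Y → Y}
    (hσ : IsRelay r b σ) (hτ : IsRelay r' b' τ) :
    IsRelay (serR r r') (serB b b') (fun p => (σ p.1, τ p.2)) := by
  obtain ⟨hσi, hσs⟩ := hσ
  obtain ⟨hτi, hτs⟩ := hτ
  refine ⟨?_, ?_⟩
  · intro z z' hz hz' he
    simp only [serB] at hz hz'
    have h1 : 1 ≤ b z.1 := le_trans hz (min_le_left _ _)
    have h2 : 1 ≤ b' z.2 := le_trans hz (min_le_right _ _)
    have h1' : 1 ≤ b z'.1 := le_trans hz' (min_le_left _ _)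
    have h2' : 1 ≤ b' z'.2 := le_trans hz' (min_le_right _ _)
    have e1 : σ z.1 = σ z'.1 := by simpa using congrArg Prod.fst he
    have e2 : τ z.2 = τ z'.2 := by simpa using congrArg Prod.snd he
    exact Prod.ext (hσi _ _ h1 h1' e1) (hτi _ _ h2 h2' e2)
  · intro z hz
    simp only [serB] at hz
    have h1 : 1 ≤ b z.1 := le_trans hz (min_le_left _ _)
    have h2 : 1 ≤ b' z.2 := le_trans hz (min_le_right _ _)
    obtain ⟨l1, r1, d1⟩ := hσs z.1 h1
    obtain ⟨l2, r2, d2⟩ := hτs z.2 h2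
    refine ⟨Prod.mk_le_mk.2 ⟨l1, l2⟩, ?_, ?_⟩
    · simp only [serR]; exact le_min r1 r2
    · simp only [serB]; omega

/-! ### Parallel composition -/

open Classical in
/-- the relay of the parallel product: move the first coordinate when it is a non-fixed blue-positive
element and the second coordinate has red label `0`; move the second coordinate when the first has blue
label `0`; fix everything else -/
noncomputable def parRelay (r' : Y → ℕ) (b : X → ℕ) (b' : Y → ℕ) (σ : X → X) (τ : Y → Y)
    (p : X × Y) : X × Y :=
  if 1 ≤ b p.1 ∧ σ p.1 ≠ p.1 ∧ r' p.2 = 0 then (σ p.1, p.2)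
  else if b p.1 = 0 ∧ 1 ≤ b' p.2 ∧ τ p.2 ≠ p.2 then (p.1, τ p.2)
  else p

/-- the first condition of `parRelay`: a non-fixed blue-positive first coordinate next to a red-0 second -/
def CondA (r' : Y → ℕ) (b : X → ℕ) (σ : X → X) (p : X × Y) : Prop := 1 ≤ b p.1 ∧ σ p.1 ≠ p.1 ∧ r' p.2 = 0

/-- the second condition of `parRelay`: a blue-0 first coordinate next to a non-fixed blue-positive second -/
def CondB (b : X → ℕ) (b' : Y → ℕ) (τ : Y → Y) (p : X × Y) : Prop := b p.1 = 0 ∧ 1 ≤ b' p.2 ∧ τ p.2 ≠ p.2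

omit [Preorder X] [Preorder Y] in
/-- the three kinds of `parRelay` -/
theorem parRelay_cases (r' : Y → ℕ) (b : X → ℕ) (b' : Y → ℕ) (σ : X → X) (τ : Y → Y) (p : X × Y) :
    (CondA r' b σ p ∧ parRelay r' b b' σ τ p = (σ p.1, p.2)) ∨
    (¬ CondA r' b σ p ∧ CondB b b' τ p ∧ parRelay r' b b' σ τ p = (p.1, τ p.2)) ∨
    (¬ CondA r' b σ p ∧ ¬ CondB b b' τ p ∧ parRelay r' b b' σ τ p = p) := by
  unfold parRelay CondA CondB
  by_cases hA : 1 ≤ b p.1 ∧ σ p.1 ≠ p.1 ∧ r' p.2 = 0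
  · left; exact ⟨hA, if_pos hA⟩
  · by_cases hB : b p.1 = 0 ∧ 1 ≤ b' p.2 ∧ τ p.2 ≠ p.2
    · right; left; exact ⟨hA, hB, by rw [if_neg hA, if_pos hB]⟩
    · right; right; exact ⟨hA, hB, by rw [if_neg hA, if_neg hB]⟩

/-- a fixed (kind C) blue-positive element of the product has red label `≥ 1` -/
theorem parRelay_red_of_fixed {r b : X → ℕ} {r' b' : Y → ℕ} {σ : X → X} {τ : Y → Y}
    (hσ : IsRelay r b σ) (hτ : IsRelay r' b' τ) {p : X × Y} (hp : 1 ≤ b p.1 + b' p.2)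
    (hnA : ¬ CondA r' b σ p) (hnB : ¬ CondB b b' τ p) : 1 ≤ r p.1 + r' p.2 := by
  unfold CondA at hnA
  unfold CondB at hnB
  by_cases hp1 : 1 ≤ b p.1
  · by_cases hr : r' p.2 = 0
    · have hfix : σ p.1 = p.1 := by
        by_contra hne
        exact hnA ⟨hp1, hne, hr⟩
      have := hσ.red_pos_of_fixed hp1 hfix
      omega
    · omega
  · have hp0 : b p.1 = 0 := by omega
    have hp2 : 1 ≤ b' p.2 := by omega
    have hfix : τ p.2 = p.2 := by
      by_contra hne
      exact hnB ⟨hp0, hp2, hne⟩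
    have := hτ.red_pos_of_fixed hp2 hfix
    omega

/-- **the parallel product of two relays is a relay** -/
theorem relay_par {r b : X → ℕ} {r' b' : Y → ℕ} {σ : X → X} {τ : Y → Y}
    (hσ : IsRelay r b σ) (hτ : IsRelay r' b' τ) :
    IsRelay (parR r r') (parB b b') (parRelay r' b b' σ τ) := by
  have hσi := hσ.1
  have hσs := hσ.2
  have hτi := hτ.1
  have hτs := hτ.2
  refine ⟨?_, ?_⟩
  · -- injectivity on the blue-positive elements of the product
    intro p q hp hq he
    simp only [parB] at hp hq
    rcases parRelay_cases r' b b' σ τ p with ⟨hA, ep⟩ | ⟨hnA, hB, ep⟩ | ⟨hnA, hnB, ep⟩ <;>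
    rcases parRelay_cases r' b b' σ τ q with ⟨hA', eq⟩ | ⟨hnA', hB', eq⟩ | ⟨hnA', hnB', eq⟩ <;>
    rw [ep, eq] at he
    · -- (A, A)
      have e1 : σ p.1 = σ q.1 := by simpa using congrArg Prod.fst he
      have e2 : p.2 = q.2 := by simpa using congrArg Prod.snd he
      exact Prod.ext (hσi _ _ hA.1 hA'.1 e1) e2
    · -- (A, B): the second coordinate of an A-image has red 0, of a B-image red ≥ 1
      exfalso
      have e2 : p.2 = τ q.2 := by simpa using congrArg Prod.snd he
      have := (hτs q.2 hB'.2.1).2.1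
      rw [← e2] at this
      have := hA.2.2
      omega
    · -- (A, C)
      exfalso
      have e1 : σ p.1 = q.1 := by simpa using congrArg Prod.fst he
      have e2 : p.2 = q.2 := by simpa using congrArg Prod.snd he
      have hred := parRelay_red_of_fixed hσ hτ hq hnA' hnB'
      by_cases hq1 : 1 ≤ b q.1
      · have hfix : σ q.1 = q.1 := by
          by_contra hne
          exact hnA' ⟨hq1, hne, by rw [← e2]; exact hA.2.2⟩
        rw [← e1] at hfix
        have : σ p.1 = p.1 := hσi _ _ (by rw [e1]; exact hq1) hA.1 hfix
        exact hA.2.1 this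
      · have hq0 : b q.1 = 0 := by omega
        have hq2 : 1 ≤ b' q.2 := by omega
        have hfix : τ q.2 = q.2 := by
          by_contra hne
          exact hnB' ⟨hq0, hq2, hne⟩
        have := hτ.red_pos_of_fixed hq2 hfix
        rw [← e2] at this
        have := hA.2.2
        omega
    · -- (B, A)
      exfalso
      have e2 : τ p.2 = q.2 := by simpa using congrArg Prod.snd he
      have := (hτs p.2 hB.2.1).2.1
      rw [e2] at this
      have := hA'.2.2
      omega
    · -- (B, B)
      have e1 : p.1 = q.1 := by simpa using congrArg Prod.fst he
      have e2 : τ p.2 = τ q.2 := by simpa using congrArg Prod.snd he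
      exact Prod.ext e1 (hτi _ _ hB.2.1 hB'.2.1 e2)
    · -- (B, C)
      exfalso
      have e1 : p.1 = q.1 := by simpa using congrArg Prod.fst he
      have e2 : τ p.2 = q.2 := by simpa using congrArg Prod.snd he
      have hq0 : b q.1 = 0 := by rw [← e1]; exact hB.1
      have hq2 : 1 ≤ b' q.2 := by omega
      have hfix : τ q.2 = q.2 := by
        by_contra hne
        exact hnB' ⟨hq0, hq2, hne⟩
      rw [← e2] at hfix
      have : τ p.2 = p.2 := hτi _ _ (by rw [e2]; exact hq2) hB.2.1 hfix
      exact hB.2.2 this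
    · -- (C, A)
      exfalso
      have e1 : p.1 = σ q.1 := by simpa using congrArg Prod.fst he
      have e2 : p.2 = q.2 := by simpa using congrArg Prod.snd he
      by_cases hp1 : 1 ≤ b p.1
      · have hfix : σ p.1 = p.1 := by
          by_contra hne
          exact hnA ⟨hp1, hne, by rw [e2]; exact hA'.2.2⟩
        rw [e1] at hfix
        have : σ q.1 = q.1 := hσi _ _ (by rw [← e1]; exact hp1) hA'.1 hfix
        exact hA'.2.1 this
      · have hp0 : b p.1 = 0 := by omega
        have hp2 : 1 ≤ b' p.2 := by omega
        have hfix : τ p.2 = p.2 := by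
          by_contra hne
          exact hnB ⟨hp0, hp2, hne⟩
        have := hτ.red_pos_of_fixed hp2 hfix
        rw [e2] at this
        have := hA'.2.2
        omega
    · -- (C, B)
      exfalso
      have e1 : p.1 = q.1 := by simpa using congrArg Prod.fst he
      have e2 : p.2 = τ q.2 := by simpa using congrArg Prod.snd he
      have hp0 : b p.1 = 0 := by rw [e1]; exact hB'.1
      have hp2 : 1 ≤ b' p.2 := by omega
      have hfix : τ p.2 = p.2 := by
        by_contra hne
        exact hnB ⟨hp0, hp2, hne⟩
      rw [e2] at hfix
      have : τ q.2 = q.2 := hτi _ _ (by rw [← e2]; exact hp2) hB'.2.1 hfix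
      exact hB'.2.2 this
    · -- (C, C)
      exact he
  · -- the relay properties
    intro p hp
    simp only [parB] at hp
    rcases parRelay_cases r' b b' σ τ p with ⟨hA, ep⟩ | ⟨hnA, hB, ep⟩ | ⟨hnA, hnB, ep⟩ <;> rw [ep]
    · obtain ⟨l1, r1, d1⟩ := hσs p.1 hA.1
      refine ⟨Prod.mk_le_mk.2 ⟨l1, le_rfl⟩, ?_, ?_⟩
      · simp only [parR]; omega
      · simp only [parB]; omega
    · obtain ⟨l2, r2, d2⟩ := hτs p.2 hB.2.1
      refine ⟨Prod.mk_le_mk.2 ⟨le_rfl, l2⟩, ?_, ?_⟩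
      · simp only [parR]; omega
      · simp only [parB]; omega
    · exact ⟨le_rfl, parRelay_red_of_fixed hσ hτ hp hnA hnB, by simp only [parB]; omega⟩

/-! ### The atoms and every series–parallel term -/

/-- the free edge: `true` (blue) relays to `false` (red) -/
theorem relay_free : IsRelay (fun c : Bool => if c then 0 else 1) (fun c : Bool => if c then 1 else 0)
    (fun _ => false) := by
  refine ⟨?_, ?_⟩
  · intro z z' hz hz' _
    cases z with
    | false => simp at hz
    | true =>
      cases z' with
      | false => simp at hz'
      | true => rfl
  · intro z hz
    cases z with
    | false => simp at hz
    | true => exact ⟨Bool.false_le _, by simp, by simp⟩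

/-- the pinned edge: the identity -/
theorem relay_pin : IsRelay (fun _ : Unit => 1) (fun _ : Unit => 1) id :=
  ⟨fun _ _ _ _ h => h, fun _ _ => ⟨le_rfl, le_rfl, by simp⟩⟩

/-- the absent edge: no blue-positive element, the identity -/
theorem relay_absent : IsRelay (fun _ : Unit => 0) (fun _ : Unit => 0) id :=
  ⟨fun _ _ _ _ h => h, fun _ h => by simp at h⟩

/-- **every series–parallel cube has a relay** -/
theorem SP.exists_relay : ∀ s : SP, ∃ σ : s.Conf → s.Conf, IsRelay s.rLab s.bLab σ
  | .free => ⟨fun _ => false, relay_free⟩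
  | .pin => ⟨id, relay_pin⟩
  | .absent => ⟨id, relay_absent⟩
  | .ser s t => by
      obtain ⟨σ, hσ⟩ := SP.exists_relay s
      obtain ⟨τ, hτ⟩ := SP.exists_relay t
      exact ⟨fun p => (σ p.1, τ p.2), relay_ser hσ hτ⟩
  | .par s t => by
      obtain ⟨σ, hσ⟩ := SP.exists_relay s
      obtain ⟨τ, hτ⟩ := SP.exists_relay t
      exact ⟨parRelay t.rLab s.bLab t.bLab σ τ, relay_par hσ hτ⟩

end Summit.Ventures.PercRepro2.V2Closure
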